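import Summits.Ventures.HodgeRepro2.T5UnitaryHeckeAdjoint
import Summits.Ventures.HodgeRepro2.T5CongruenceConjugation
import Summits.Ventures.HodgeRepro2.T5PadicHeckeCommutative

/-!
# T5CartanFinOne — the Cartan hypothesis holds for `U(1)`: a non-vacuity witness of `IsCartanDecomposition`

Blind cell pub-hodge-repro2, seat p8, Tier-5 kernel support (continuation of T5UnitaryHeckeAdjoint).

T5UnitaryGroupForm / T5UnitaryHeckeAdjoint take the printed Cartan decomposition as the hypothesis
`IsCartanDecomposition R J σ ϖ`. This file shows the hypothesis is SATISFIABLE — it is proved, not assumed, in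
the one-variable case: for `ι = Fin 1`, `J = (u)` with `u ≠ 0`, `R` a valuation ring (every DVR) with fraction
field `E`, and an involution `star` of `E` that preserves `R`-integrality,
* `isInteger_and_isInteger_inv_of_star_mul_self`: a norm-one element (`star x * x = 1`) is integral with
  integral inverse (`x` or `x⁻¹` is integral, and `star x = x⁻¹`);
* `mem_range_of_mem_formUnitaryGroup_fin_one`: hence `U((u)) ⊆ GL_1(R)`, i.e. `U((u)) = K_U`;
* `isCartanDecomposition_fin_one`: `IsCartanDecomposition R (u) Fin.revPerm ϖ` holds (every `g` is
  `g · diag(ϖ^0) · 1`, and `m = 0` is the only `rev`-antisymmetric exponent on `Fin 1`);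
* `isCartanDecomposition_padic`: the fully concrete instance `ℤ_[p] ⊂ ℚ_[p]` with the trivial involution —
  every hypothesis of T5UnitaryHeckeAdjoint's theorems is met at once, so `heckeAlgebra_mul_comm_padic_fin_one`
  holds with NO hypothesis (mathematically trivial — `U(1)` is abelian — but it certifies that the hypothesis
  list of T5UnitaryHeckeAdjoint is jointly satisfiable; cf. T5PadicHeckeCommutative for `GL_n`).

For `n ≥ 2` the Cartan decomposition of `U(J)` remains the printed hypothesis.
-/

namespace Summit.Ventures.HodgeRepro2.T5CartanFinOne

open Summit.Ventures.HodgeRepro2 Matrix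

section FinOne

variable {E : Type*}

/-- Every `1 × 1` matrix is `rev`-persymmetric (`Fin.revPerm` is the identity on `Fin 1`). -/
theorem rev_rev_fin_one (J : Matrix (Fin 1) (Fin 1) E) (i j : Fin 1) :
    J (Fin.revPerm i) (Fin.revPerm j) = J i j := by
  rw [Subsingleton.elim (Fin.revPerm i) i, Subsingleton.elim (Fin.revPerm j) j]

end FinOne

section NormOne

variable {R : Type*} [CommRing R] [IsDomain R] {E : Type*} [Field E] [StarRing E] [Algebra R E]
  [IsFractionRing R E]

/-- In the fraction field of a valuation ring, if the involution preserves integrality then a norm-one element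
`x` (`star x * x = 1`) is integral with integral inverse: one of `x, x⁻¹` is integral, and `star x = x⁻¹`. -/
theorem isInteger_and_isInteger_inv_of_star_mul_self [ValuationRing R]
    (hstar : ∀ x : E, IsLocalization.IsInteger R x → IsLocalization.IsInteger R (star x))
    {x : E} (hx : star x * x = 1) :
    IsLocalization.IsInteger R x ∧ IsLocalization.IsInteger R x⁻¹ := by
  have hsx : star x = x⁻¹ := eq_inv_of_mul_eq_one_left hx
  rcases ValuationRing.isInteger_or_isInteger R x with h | h
  · exact ⟨h, hsx ▸ hstar x h⟩
  · refine ⟨?_, h⟩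
    have := hstar _ h
    rwa [star_inv₀, hsx, inv_inv] at this

omit [StarRing E] in
/-- The `(0,0)` entry of a `1 × 1` product. -/
theorem mul_apply_fin_one (A B : Matrix (Fin 1) (Fin 1) E) (i j : Fin 1) :
    (A * B) i j = A i 0 * B 0 j := by
  rw [Matrix.mul_apply, Fin.sum_univ_one]


/-- A `1 × 1` unitary element: `g ∈ U((u))` with `u ≠ 0` forces `star (g 0 0) * g 0 0 = 1`. -/
theorem star_mul_self_of_mem_formUnitaryGroup_fin_one {u : E} (hu : u ≠ 0) {g : GL (Fin 1) E}
    (hg : g ∈ T5UnitaryGroupForm.formUnitaryGroup (diagonal fun _ : Fin 1 => u)) :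
    star ((g : Matrix (Fin 1) (Fin 1) E) 0 0) * (g : Matrix (Fin 1) (Fin 1) E) 0 0 = 1 := by
  rw [T5UnitaryGroupForm.mem_formUnitaryGroup_iff] at hg
  have h := congrFun (congrFun hg 0) 0
  rw [mul_apply_fin_one, mul_apply_fin_one, conjTranspose_apply, diagonal_apply_eq] at h
  have h' : (star ((g : Matrix (Fin 1) (Fin 1) E) 0 0) * (g : Matrix (Fin 1) (Fin 1) E) 0 0) * u = u := by
    calc (star ((g : Matrix (Fin 1) (Fin 1) E) 0 0) * (g : Matrix (Fin 1) (Fin 1) E) 0 0) * u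
        = star ((g : Matrix (Fin 1) (Fin 1) E) 0 0) * u * (g : Matrix (Fin 1) (Fin 1) E) 0 0 := by ring
      _ = u := h
  exact mul_right_cancel₀ hu (by rw [h', one_mul])

/-- `U((u)) ⊆ GL_1(R)`: every element of the one-variable unitary group is integral with integral inverse
(T5CongruenceConjugation's `mem_range_of_map_eq` on the `1 × 1` matrices `(r)`, `(r')`). -/
theorem mem_range_of_mem_formUnitaryGroup_fin_one [ValuationRing R]
    (hstar : ∀ x : E, IsLocalization.IsInteger R x → IsLocalization.IsInteger R (star x))
    {u : E} (hu : u ≠ 0) {g : GL (Fin 1) E}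
    (hg : g ∈ T5UnitaryGroupForm.formUnitaryGroup (diagonal fun _ : Fin 1 => u)) :
    g ∈ (Matrix.GeneralLinearGroup.map (algebraMap R E)).range := by
  obtain ⟨⟨r, hr⟩, ⟨r', hr'⟩⟩ :=
    isInteger_and_isInteger_inv_of_star_mul_self hstar (star_mul_self_of_mem_formUnitaryGroup_fin_one hu hg)
  have hinv : ((g⁻¹ : GL (Fin 1) E) : Matrix (Fin 1) (Fin 1) E) 0 0 =
      ((g : Matrix (Fin 1) (Fin 1) E) 0 0)⁻¹ := by
    apply eq_inv_of_mul_eq_one_left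
    have h := congrFun (congrFun (Units.inv_mul g) 0) 0
    rwa [mul_apply_fin_one, Matrix.one_apply_eq] at h
  refine T5CongruenceConjugation.mem_range_of_map_eq (IsFractionRing.injective R E) g
    (diagonal fun _ => r) (diagonal fun _ => r') ?_ ?_
  · ext i j
    rw [Matrix.map_apply, Subsingleton.elim i 0, Subsingleton.elim j 0, diagonal_apply_eq, hr]
  · ext i j
    rw [Matrix.map_apply, Subsingleton.elim i 0, Subsingleton.elim j 0, diagonal_apply_eq, hr', hinv]

/-- THE CARTAN HYPOTHESIS HOLDS FOR `U(1)`: `IsCartanDecomposition R (u) Fin.revPerm ϖ` for every unit `ϖ`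
(every `g` is `g · diag(ϖ^0) · 1` with `g ∈ K_U`; `m = 0`). -/
theorem isCartanDecomposition_fin_one [ValuationRing R]
    (hstar : ∀ x : E, IsLocalization.IsInteger R x → IsLocalization.IsInteger R (star x))
    {u : E} (hu : u ≠ 0) (ϖ : Eˣ) :
    T5UnitaryHeckeAdjoint.IsCartanDecomposition R (diagonal fun _ : Fin 1 => u) Fin.revPerm ϖ := by
  intro g
  refine ⟨g, (T5UnitaryHeckeAdjoint.mem_hyperspecialSubgroup_iff R g).2
      (mem_range_of_mem_formUnitaryGroup_fin_one hstar hu g.2), 1, one_mem _, 0, fun _ => by simp, ?_⟩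
  have h1 : T5CartanUniformiser.diagonalUnit (fun i : Fin 1 => ϖ ^ ((0 : Fin 1 → ℤ) i)) = 1 := by
    apply Units.ext
    rw [T5CartanUniformiser.coe_diagonalUnit, Units.val_one]
    simp only [Pi.zero_apply, zpow_zero, Units.val_one, diagonal_one]
  rw [h1, Subgroup.coe_one, mul_one, mul_one]

end NormOne

section Padic

variable (p : ℕ) [Fact p.Prime]

/-- The concrete instance: `ℤ_[p] ⊂ ℚ_[p]` with the trivial involution (`star = id`, `starRingOfComm`):
`IsCartanDecomposition ℤ_[p] (1) Fin.revPerm ϖ` holds for every unit `ϖ` of `ℚ_[p]`. -/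
theorem isCartanDecomposition_padic (ϖ : ℚ_[p]ˣ) :
    letI : StarRing ℚ_[p] := starRingOfComm
    T5UnitaryHeckeAdjoint.IsCartanDecomposition ℤ_[p] (diagonal fun _ : Fin 1 => (1 : ℚ_[p]))
      Fin.revPerm ϖ := by
  letI : StarRing ℚ_[p] := starRingOfComm
  exact isCartanDecomposition_fin_one (fun x hx => hx) one_ne_zero ϖ

/-- `H(U(1)(ℚ_p), U(1)(ℤ_p))` is commutative with NO hypothesis (trivial — `U(1)` is abelian — but every
hypothesis of T5UnitaryHeckeAdjoint's `heckeAlgebra_mul_comm` is discharged here at once: the DVR `ℤ_[p]` with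
finite residue field (T5PadicHeckeCommutative), the persymmetry of `(1)`, and the Cartan decomposition). -/
theorem heckeAlgebra_mul_comm_padic_fin_one (ϖ : ℚ_[p]ˣ) (k : Type*) [Field k] :
    letI : StarRing ℚ_[p] := starRingOfComm
    ∀ T S : T5HeckePermutationModule.heckeAlgebra k
      (T5UnitaryHeckeAdjoint.hyperspecialSubgroup ℤ_[p] (diagonal fun _ : Fin 1 => (1 : ℚ_[p]))),
      T * S = S * T := by
  letI : StarRing ℚ_[p] := starRingOfComm
  haveI := T5PadicHeckeCommutative.finite_residueField_padicInt p
  exact T5UnitaryHeckeAdjoint.heckeAlgebra_mul_comm (σ := Fin.revPerm) (ϖ := ϖ) (rev_rev_fin_one _)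
    (isCartanDecomposition_padic p ϖ) k

end Padic

end Summit.Ventures.HodgeRepro2.T5CartanFinOne
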